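import Summits.QuantumFields.QCD.Theorems.SpectralDefectExtinctionExtinctionBuildsQCDStubHermitianWilsonCombesThomas
import Summits.QuantumFields.QCD.Theses.WilsonMobilityGap
import Literature.Barriers.QuantumFields.WilsonDeterminantSign
import Literature.Analysis.Matrix.CoerciveCombesThomas
import Literature.MathematicalPhysics.QuantumLattice.WilsonDiracRangeOne

/-!
# Crux `MobilityGap` (stmt-QuantumFields-9150), line `Ideator6Sketch`, stub `stub_pocketPlateau` (S1a) —
# deterministic, `η`-uniform decay of the valence resolvent in the doubler pocket on gapped / admissible fields

The stub `stub_pocketPlateau` (an Aizenman–Molchanov bound for `(Γ₅ D_W(U,m₀,1) − E − iη)⁻¹`,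
`m₀ ∈ [-3/2,-1]`, `|E| ≤ E₀`, ALL `η > 0`, under the reweighted Wilson measure) has three physics
inputs: (a) the admissibility gap of the Wilson kernel at `m₀ = −1` on smooth fields, (b) large-field
diluteness at weak coupling, (c) a Wegner-type decoupling for Gibbs `SU(3)` link disorder.  This file
settles the deterministic consequence of (a), uniformly in `η ∈ ℝ` (including `η = 0`):

* `pocketDecay_of_gap` (registered fragment) — for every torus, every `SU(3)` field `U` whose Wilson
  kernel at `m₀ = −1` has the quadratic lower bound `‖D_W(U,−1,1)ψ‖² ≥ (9/10)‖ψ‖²`, every valence mass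
  with `|m₀ + 1| ≤ 1/2` (so the whole pocket `[-3/2,-1]` and beyond), every energy `|E| ≤ 1/8` and EVERY
  real `η`:  `‖(Γ₅ D_W(U,m₀,1) − (E + iη))⁻¹(p,q)‖ ≤ 8 · exp(−‖p − q‖₁/1600)` in the periodic taxi distance.
  Mechanism: `Γ₅ D_W(m₀) − E = Γ₅ (D_W(−1) + (m₀+1) − E Γ₅)`, `Γ₅` a diagonal sign matrix, so coordinatewise
  `‖((Γ₅D_W(m₀) − E)ψ)_i‖ = ‖(D_W(−1)ψ)_i + ((m₀+1) ∓ E) ψ_i‖`; the elementary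
  `‖a + b‖² ≥ ‖a‖²/3 − ‖b‖²/2` and `|m₀+1| + |E| ≤ 5/8` give the floor
  `‖(Γ₅D_W(m₀) − E − iη)ψ‖² ≥ ‖(Γ₅D_W(m₀) − E)ψ‖² ≥ (3/10 − 25/128)‖ψ‖² ≥ (1/4)²‖ψ‖²`, and the coercive
  Combes–Thomas bound (`Literature.Analysis.Matrix.coercive_combes_thomas`; range one, off-site sums
  `≤ 96`, `96(e^{1/1600} − 1) ≤ 1/8`) does the rest.
* `pocketDecay_of_admissible` — the same conclusion for every `ε`-admissible field, `ε ≤ 1/300`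
  (`‖1 − U(p)‖ ≤ ε` on all plaquettes), CONDITIONAL on the tree's named fact
  `HJLLocality (fundamentalRep (Fin 3))` (Hernández–Jansen–Lüscher 1999, (2.16): admissibility ⟹
  `D_W(−1)ᴴ D_W(−1) ≥ 1 − 30ε`).

What it buys for S1a: on the admissible (smooth-field) event the valence resolvent in the pocket is
exponentially localised for all `η`, deterministically and uniformly in the sea; the stub's open
content is thereby confined to the rough-field contribution ((b) + (c)).

References (prose): Hernández–Jansen–Lüscher, Nucl. Phys. B 552 (1999) 363, (2.14)–(2.16);
Neuberger, Phys. Rev. D 61 (2000) 085015; Combes–Thomas, Comm. Math. Phys. 34 (1973) 251;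
Aizenman–Warzel, GSM 168 (2015), §10.3.  Pure theorem file (no definitions).
-/

noncomputable section

namespace Summit.QuantumFields.QCD.Theorems.MobilityGapPinch

open scoped BigOperators Topology ComplexConjugate
open MeasureTheory Filter Set Matrix Complex Finset
open Literature.MathematicalPhysics.QuantumFieldTheory Literature.MathematicalPhysics.QuantumLattice
  Literature.Probability.LatticeModels Literature.Barriers.QuantumFields.WilsonDeterminant
open Summit.QuantumFields.QCD.Cruxes.ExtinctionBuildsQCD.WeylWindow

/-! ### Elementary inequalities -/

/-- `‖a + b‖² ≥ ‖a‖²/3 − ‖b‖²/2` (from `‖a + b‖ ≥ |‖a‖ − ‖b‖|` and `2xy ≤ (2/3)x² + (3/2)y²`). -/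
theorem norm_add_sq_ge_third_sub_half (a b : ℂ) : ‖a‖ ^ 2 / 3 - ‖b‖ ^ 2 / 2 ≤ ‖a + b‖ ^ 2 := by
  have h1 : |‖a‖ - ‖b‖| ≤ ‖a + b‖ := by simpa using abs_norm_sub_norm_le a (-b)
  have h2 : (‖a‖ - ‖b‖) ^ 2 ≤ ‖a + b‖ ^ 2 := by
    rw [← sq_abs (‖a‖ - ‖b‖)]
    exact pow_le_pow_left₀ (abs_nonneg _) h1 2
  nlinarith [sq_nonneg (2 * ‖a‖ - 3 * ‖b‖), norm_nonneg a, norm_nonneg b]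

/-- Dropping `iη` only lowers `‖(H − iη)v‖²` for Hermitian `H`:
`Σ‖(Hv)_i‖² ≤ Σ‖((H − iη)v)_i‖²` (the cross term `Re(iη⟨Hv,v⟩)` vanishes). -/
theorem sum_norm_sq_mulVec_le_of_isHermitian {n : Type*} [Fintype n] [DecidableEq n]
    {H : Matrix n n ℂ} (hH : H.IsHermitian) (η : ℝ) (v : n → ℂ) :
    ∑ i, ‖(H *ᵥ v) i‖ ^ 2 ≤ ∑ i, ‖((H - ((η : ℂ) * Complex.I) • (1 : Matrix n n ℂ)) *ᵥ v) i‖ ^ 2 := by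
  have hAv : ∀ i, ((H - ((η : ℂ) * Complex.I) • (1 : Matrix n n ℂ)) *ᵥ v) i =
      (H *ᵥ v) i - ((η : ℂ) * Complex.I) * v i := by
    intro i
    rw [sub_mulVec, smul_mulVec, one_mulVec, Pi.sub_apply, Pi.smul_apply, smul_eq_mul]
  simp only [hAv]
  rw [sum_norm_sq_sub_mul]
  set S : ℂ := star (H *ᵥ v) ⬝ᵥ v with hS
  have hSreal : S.im = 0 := by
    have h := congrArg Complex.im (star_dotProduct_mulVec_self_real hH v)
    rw [← hS, Complex.star_def, Complex.conj_im] at h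
    linarith
  have hcross : (((η : ℂ) * Complex.I) * S).re = 0 := by
    simp [Complex.mul_re, hSreal]
  rw [hcross, mul_zero, sub_zero]
  have : 0 ≤ ‖(η : ℂ) * Complex.I‖ ^ 2 * ∑ i, ‖v i‖ ^ 2 :=
    mul_nonneg (sq_nonneg _) (Finset.sum_nonneg fun i _ => by positivity)
  linarith

/-- The bare mass enters the Wilson–Dirac matrix additively on the diagonal:
`D_W(U,m,r) = D_W(U,m',r) + (m − m')·1`. -/
theorem wilsonDirac_eq_add_sub_smul_one {L N : ℕ} {G : Type*} [Group G]
    (ρ : G →* Matrix (Fin N) (Fin N) ℂ) (U : GaugeConfig 4 L G) (m m' r : ℝ) :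
    wilsonDirac ρ U m r = wilsonDirac ρ U m' r + ((m - m' : ℝ) : ℂ) • 1 := by
  ext p q
  rw [Matrix.add_apply, Matrix.smul_apply, Matrix.one_apply]
  simp only [wilsonDirac, Matrix.of_apply]
  by_cases h : p = q
  · rw [if_pos h, if_pos h, if_pos h, smul_eq_mul]; push_cast; ring
  · rw [if_neg h, if_neg h, if_neg h, smul_zero, add_zero]

/-! ### The pocket floor and the decay -/

/-- **Pocket floor.**  If `‖D_W(U,−1,1)ψ‖² ≥ (9/10)‖ψ‖²` for all `ψ`, then for `|m₀ + 1| ≤ 1/2`,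
`|E| ≤ 1/8` and every real `η`:
`(1/4)² Σ‖ψ_i‖² ≤ Σ‖((Γ₅ D_W(U,m₀,1) − (E + iη)) ψ)_i‖²`. [folklore] -/
theorem pocket_floor {L : ℕ} [NeZero L] (U : GaugeConfig 4 L (Matrix.specialUnitaryGroup (Fin 3) ℂ))
    (hgap : ∀ ψ : TorusSite 4 L × Fin 3 × Fin 4 → ℂ,
      (9 / 10 : ℝ) * ∑ i, ‖ψ i‖ ^ 2 ≤ ∑ i, ‖(wilsonDirac (fundamentalRep (Fin 3)) U (-1) 1 *ᵥ ψ) i‖ ^ 2)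
    (m₀ E η : ℝ) (hm : |m₀ + 1| ≤ 1 / 2) (hE : |E| ≤ 1 / 8)
    (ψ : TorusSite 4 L × Fin 3 × Fin 4 → ℂ) :
    (1 / 4 : ℝ) ^ 2 * ∑ i, ‖ψ i‖ ^ 2 ≤
      ∑ i, ‖((hermitianWilsonDirac (fundamentalRep (Fin 3)) U m₀ 1 -
        ((E : ℂ) + (η : ℂ) * Complex.I) •
          (1 : Matrix (TorusSite 4 L × Fin 3 × Fin 4) (TorusSite 4 L × Fin 3 × Fin 4) ℂ)) *ᵥ ψ) i‖ ^ 2 := by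
  -- notation
  set Γ : Matrix (TorusSite 4 L × Fin 3 × Fin 4) (TorusSite 4 L × Fin 3 × Fin 4) ℂ :=
    spinorLift gammaFive with hΓ
  set D₁ : Matrix (TorusSite 4 L × Fin 3 × Fin 4) (TorusSite 4 L × Fin 3 × Fin 4) ℂ :=
    wilsonDirac (fundamentalRep (Fin 3)) U (-1) 1 with hD₁
  set D : Matrix (TorusSite 4 L × Fin 3 × Fin 4) (TorusSite 4 L × Fin 3 × Fin 4) ℂ :=
    wilsonDirac (fundamentalRep (Fin 3)) U m₀ 1 with hD
  set H : Matrix (TorusSite 4 L × Fin 3 × Fin 4) (TorusSite 4 L × Fin 3 × Fin 4) ℂ :=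
    hermitianWilsonDirac (fundamentalRep (Fin 3)) U m₀ 1 with hHdef
  have hρ : ∀ g : Matrix.specialUnitaryGroup (Fin 3) ℂ,
      fundamentalRep (Fin 3) g ∈ Matrix.unitaryGroup (Fin 3) ℂ :=
    fun g => fundamentalRep_mem_unitaryGroup g
  have hHΓ : H = Γ * D := rfl
  -- the diagonal sign matrix `Γ₅`
  set d : TorusSite 4 L × Fin 3 × Fin 4 → ℂ := fun p => (![1, 1, -1, -1] : Fin 4 → ℂ) p.2.2 with hd
  have hΓd : Γ = diagonal d := spinorLift_gammaFive_eq_diagonal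
  have hd1 : ∀ i, ‖d i‖ = 1 := by
    rintro ⟨x, a, α⟩
    fin_cases α <;> simp [hd]
  -- (1) drop `iη`: `H − E` is Hermitian
  have hHE : (H - (E : ℂ) • (1 : Matrix _ _ ℂ)).IsHermitian := by
    refine (isHermitian_hermitianWilsonDirac (fundamentalRep (Fin 3)) hρ U m₀ 1).sub ?_
    unfold Matrix.IsHermitian
    rw [conjTranspose_smul, conjTranspose_one, Complex.star_def, Complex.conj_ofReal]
  have hA : H - ((E : ℂ) + (η : ℂ) * Complex.I) • (1 : Matrix _ _ ℂ) =
      H - (E : ℂ) • (1 : Matrix _ _ ℂ) - ((η : ℂ) * Complex.I) • 1 := by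
    rw [add_smul, sub_sub]
  have hdrop := sum_norm_sq_mulVec_le_of_isHermitian hHE η ψ
  rw [← hA] at hdrop
  refine le_trans ?_ hdrop
  -- (2) `(H − E) ψ = Γ ((D − E Γ) ψ)` coordinatewise, `Γ` a sign
  have hfac : H - (E : ℂ) • (1 : Matrix _ _ ℂ) = Γ * (D - (E : ℂ) • Γ) := by
    rw [Matrix.mul_sub, Matrix.mul_smul, hΓ, spinorLift_gammaFive_mul_self, ← hΓ, hHΓ]
  have hcoord : ∀ i, ‖((H - (E : ℂ) • (1 : Matrix _ _ ℂ)) *ᵥ ψ) i‖ = ‖((D - (E : ℂ) • Γ) *ᵥ ψ) i‖ := by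
    intro i
    rw [hfac, ← Matrix.mulVec_mulVec, hΓd, mulVec_diagonal, norm_mul, hd1, one_mul]
  simp_rw [hcoord]
  -- (3) `(D − EΓ)ψ = D₁ψ + b`, `b_i = (m₀+1) ψ_i − E d_i ψ_i`
  have hDD : D = D₁ + ((m₀ + 1 : ℝ) : ℂ) • 1 := by
    have h := wilsonDirac_eq_add_sub_smul_one (fundamentalRep (Fin 3)) U m₀ (-1) 1
    rw [sub_neg_eq_add] at h
    exact h
  have hsplit : ∀ i, ((D - (E : ℂ) • Γ) *ᵥ ψ) i =
      (D₁ *ᵥ ψ) i + (((m₀ + 1 : ℝ) : ℂ) * ψ i - (E : ℂ) * (d i * ψ i)) := by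
    intro i
    rw [hDD, hΓd]
    simp only [sub_mulVec, add_mulVec, smul_mulVec, one_mulVec, mulVec_diagonal, Pi.sub_apply,
      Pi.add_apply, Pi.smul_apply, smul_eq_mul]
    ring
  simp_rw [hsplit]
  -- (4) the perturbation is small coordinatewise: `‖b_i‖ ≤ (5/8)‖ψ_i‖`
  have hb : ∀ i, ‖((m₀ + 1 : ℝ) : ℂ) * ψ i - (E : ℂ) * (d i * ψ i)‖ ≤ 5 / 8 * ‖ψ i‖ := by
    intro i
    calc ‖((m₀ + 1 : ℝ) : ℂ) * ψ i - (E : ℂ) * (d i * ψ i)‖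
        ≤ ‖((m₀ + 1 : ℝ) : ℂ) * ψ i‖ + ‖(E : ℂ) * (d i * ψ i)‖ := norm_sub_le _ _
      _ = |m₀ + 1| * ‖ψ i‖ + |E| * ‖ψ i‖ := by
          rw [norm_mul, norm_mul, norm_mul, hd1, one_mul, Complex.norm_real, Complex.norm_real,
            Real.norm_eq_abs, Real.norm_eq_abs]
      _ ≤ 1 / 2 * ‖ψ i‖ + 1 / 8 * ‖ψ i‖ := by
          gcongr
      _ = 5 / 8 * ‖ψ i‖ := by ring
  -- (5) sum the elementary inequality
  have hsum : ∑ i, (‖(D₁ *ᵥ ψ) i‖ ^ 2 / 3 - (5 / 8 * ‖ψ i‖) ^ 2 / 2) ≤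
      ∑ i, ‖(D₁ *ᵥ ψ) i + (((m₀ + 1 : ℝ) : ℂ) * ψ i - (E : ℂ) * (d i * ψ i))‖ ^ 2 := by
    refine Finset.sum_le_sum fun i _ => le_trans ?_ (norm_add_sq_ge_third_sub_half _ _)
    have h := hb i
    have h0 : 0 ≤ ‖((m₀ + 1 : ℝ) : ℂ) * ψ i - (E : ℂ) * (d i * ψ i)‖ := norm_nonneg _
    nlinarith
  refine le_trans ?_ hsum
  rw [Finset.sum_sub_distrib, ← Finset.sum_div, ← Finset.sum_div]
  have hg := hgap ψ
  have hψ2 : ∑ i, (5 / 8 * ‖ψ i‖) ^ 2 = (25 / 64 : ℝ) * ∑ i, ‖ψ i‖ ^ 2 := by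
    rw [Finset.mul_sum]
    exact Finset.sum_congr rfl fun i _ => by ring
  rw [hψ2]
  have hN : 0 ≤ ∑ i, ‖ψ i‖ ^ 2 := Finset.sum_nonneg fun i _ => by positivity
  nlinarith

/-- **Fragment of `stub_pocketPlateau` (S1a): deterministic `η`-uniform pocket decay on gapped fields.**
For every torus `(ℤ/L)⁴`, every `SU(3)` field `U` with `‖D_W(U,−1,1)ψ‖² ≥ (9/10)‖ψ‖²` for all `ψ`,
every valence mass with `|m₀ + 1| ≤ 1/2`, every energy `|E| ≤ 1/8`, every real `η` and all indices:
`‖(Γ₅ D_W(U,m₀,1) − (E + iη))⁻¹(p,q)‖ ≤ 8 · exp(−‖p.1 − q.1‖₁/1600)`. [folklore] -/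
theorem pocketDecay_of_gap : ∀ (L : ℕ) [NeZero L] (U : GaugeConfig 4 L (Matrix.specialUnitaryGroup (Fin 3) ℂ)),
    (∀ ψ : TorusSite 4 L × Fin 3 × Fin 4 → ℂ,
      (9 / 10 : ℝ) * ∑ i, ‖ψ i‖ ^ 2 ≤ ∑ i, ‖(wilsonDirac (fundamentalRep (Fin 3)) U (-1) 1 *ᵥ ψ) i‖ ^ 2) →
    ∀ (m₀ E η : ℝ), |m₀ + 1| ≤ 1 / 2 → |E| ≤ 1 / 8 →
      ∀ p q : TorusSite 4 L × Fin 3 × Fin 4,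
        ‖(hermitianWilsonDirac (fundamentalRep (Fin 3)) U m₀ 1 -
            ((E : ℂ) + (η : ℂ) * Complex.I) •
              (1 : Matrix (TorusSite 4 L × Fin 3 × Fin 4) (TorusSite 4 L × Fin 3 × Fin 4) ℂ))⁻¹ p q‖ ≤
          8 * Real.exp (-((torusTaxiDist p.1 q.1 : ℝ) / 1600)) := by
  intro L _ U hgap m₀ E η hm hE p q
  set H : Matrix (TorusSite 4 L × Fin 3 × Fin 4) (TorusSite 4 L × Fin 3 × Fin 4) ℂ :=
    hermitianWilsonDirac (fundamentalRep (Fin 3)) U m₀ 1 with hHdef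
  set A : Matrix (TorusSite 4 L × Fin 3 × Fin 4) (TorusSite 4 L × Fin 3 × Fin 4) ℂ :=
    H - ((E : ℂ) + (η : ℂ) * Complex.I) • 1 with hAdef
  have hρ : ∀ g : Matrix.specialUnitaryGroup (Fin 3) ℂ,
      fundamentalRep (Fin 3) g ∈ Matrix.unitaryGroup (Fin 3) ℂ :=
    fun g => fundamentalRep_mem_unitaryGroup g
  -- off-site entries of `A` are entries of `H_W`, with the moduli of `D_W`
  have hoff : ∀ p q : TorusSite 4 L × Fin 3 × Fin 4, p ≠ q →
      ‖A p q‖ = ‖wilsonDirac (fundamentalRep (Fin 3)) U m₀ 1 p q‖ := by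
    intro p q hpq
    rw [hAdef, Matrix.sub_apply, Matrix.smul_apply, one_apply_ne hpq, smul_zero, sub_zero, hHdef,
      hermitianWilsonDirac, ct_norm_hW_apply]
  -- range one in the taxi distance of the sites
  have hrange : ∀ p q : TorusSite 4 L × Fin 3 × Fin 4, A p q ≠ 0 → torusTaxiDist p.1 q.1 ≤ 1 := by
    intro p q h
    by_cases hpq : p = q
    · rw [hpq, torusTaxiDist_self]; exact zero_le_one
    · refine torusTaxiDist_le_one_of_wilsonDirac_ne_zero (fundamentalRep (Fin 3)) hρ U m₀ p q ?_
      intro h0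
      exact h (norm_eq_zero.1 (by rw [hoff p q hpq, h0, norm_zero]))
  -- off-site row and column sums `≤ 96`
  have hrow : ∀ p, ∑ q ∈ univ.filter (fun q : TorusSite 4 L × Fin 3 × Fin 4 => torusTaxiDist p.1 q.1 ≠ 0),
      ‖A p q‖ ≤ 96 := by
    intro p
    calc _ = ∑ q ∈ univ.filter (fun q : TorusSite 4 L × Fin 3 × Fin 4 => torusTaxiDist p.1 q.1 ≠ 0),
          ‖wilsonDirac (fundamentalRep (Fin 3)) U m₀ 1 p q‖ := by
          refine Finset.sum_congr rfl fun q hq => hoff p q ?_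
          rintro rfl
          exact (Finset.mem_filter.1 hq).2 (torusTaxiDist_self _)
      _ ≤ 32 * (3 : ℕ) := wilsonDirac_rowSum_torusTaxiDist_le (fundamentalRep (Fin 3)) hρ U m₀ p
      _ = 96 := by norm_num
  have hcol : ∀ q, ∑ p ∈ univ.filter (fun p : TorusSite 4 L × Fin 3 × Fin 4 => torusTaxiDist p.1 q.1 ≠ 0),
      ‖A p q‖ ≤ 96 := by
    intro q
    calc _ = ∑ p ∈ univ.filter (fun p : TorusSite 4 L × Fin 3 × Fin 4 => torusTaxiDist p.1 q.1 ≠ 0),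
          ‖wilsonDirac (fundamentalRep (Fin 3)) U m₀ 1 p q‖ := by
          refine Finset.sum_congr rfl fun p hp => hoff p q ?_
          rintro rfl
          exact (Finset.mem_filter.1 hp).2 (torusTaxiDist_self _)
      _ ≤ 32 * (3 : ℕ) := wilsonDirac_colSum_torusTaxiDist_le (fundamentalRep (Fin 3)) hρ U m₀ q
      _ = 96 := by norm_num
  -- the pocket floor `g = 1/4`
  have hfloor : ∀ v : TorusSite 4 L × Fin 3 × Fin 4 → ℂ,
      (1 / 4 : ℝ) ^ 2 * ∑ i, ‖v i‖ ^ 2 ≤ ∑ i, ‖(A *ᵥ v) i‖ ^ 2 :=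
    fun v => pocket_floor U hgap m₀ E η hm hE v
  -- the rate `θ = 1/1600`: `96 (e^θ − 1) ≤ 192 θ ≤ 1/8`
  have hθ : (96 : ℝ) * (Real.exp (1 / 1600) - 1) ≤ (1 / 4) / 2 := by
    have h1 := Real.abs_exp_sub_one_le (x := 1 / 1600) (by norm_num)
    rw [abs_of_nonneg (by norm_num : (0 : ℝ) ≤ 1 / 1600),
      abs_of_nonneg (by linarith [Real.add_one_le_exp (1 / 1600 : ℝ)])] at h1
    linarith
  obtain ⟨-, hB⟩ := Literature.Analysis.Matrix.coercive_combes_thomas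
    (fun p q : TorusSite 4 L × Fin 3 × Fin 4 => torusTaxiDist p.1 q.1)
    (fun p => torusTaxiDist_self p.1) (fun p q => torusTaxiDist_comm p.1 q.1)
    (fun p q r => torusDistOne_triangle (Ls := fun _ : Fin 4 => L) p.1 q.1 r.1)
    A hrange 96 hrow hcol (1 / 4) (1 / 1600) (by norm_num) (by norm_num) hfloor hθ
  have h := hB p q
  refine h.trans (le_of_eq ?_)
  rw [show (2 : ℝ) / (1 / 4) = 8 by norm_num]
  congr 2
  ring

/-- **Corollary (conditional on the named fact `HJLLocality`, Hernández–Jansen–Lüscher 1999 (2.16)):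
`η`-uniform pocket decay on admissible fields.**  Assuming `HJLLocality (fundamentalRep (Fin 3))`: for
every torus, every `SU(3)` field `U` with `‖1 − U(p)‖ ≤ ε` on all plaquettes, `ε ≤ 1/300`, every
`|m₀ + 1| ≤ 1/2`, `|E| ≤ 1/8`, every real `η` and all indices,
`‖(Γ₅ D_W(U,m₀,1) − (E + iη))⁻¹(p,q)‖ ≤ 8 · exp(−‖p.1 − q.1‖₁/1600)`. -/
theorem pocketDecay_of_admissible (hHJL : HJLLocality (fundamentalRep (Fin 3))) :
    ∀ (L : ℕ) [NeZero L] (U : GaugeConfig 4 L (Matrix.specialUnitaryGroup (Fin 3) ℂ)) (ε : ℝ),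
      ε ≤ 1 / 300 → IsNormAdmissible (fundamentalRep (Fin 3)) U ε →
      ∀ (m₀ E η : ℝ), |m₀ + 1| ≤ 1 / 2 → |E| ≤ 1 / 8 →
        ∀ p q : TorusSite 4 L × Fin 3 × Fin 4,
          ‖(hermitianWilsonDirac (fundamentalRep (Fin 3)) U m₀ 1 -
              ((E : ℂ) + (η : ℂ) * Complex.I) •
                (1 : Matrix (TorusSite 4 L × Fin 3 × Fin 4) (TorusSite 4 L × Fin 3 × Fin 4) ℂ))⁻¹ p q‖ ≤
            8 * Real.exp (-((torusTaxiDist p.1 q.1 : ℝ) / 1600)) := by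
  intro L _ U ε hε hadm m₀ E η hm hE p q
  refine pocketDecay_of_gap L U (fun ψ => ?_) m₀ E η hm hE p q
  have h := hHJL.1 (fun g => fundamentalRep_mem_unitaryGroup g) U ε hadm ψ
  have hN : 0 ≤ ∑ i, ‖ψ i‖ ^ 2 := Finset.sum_nonneg fun i _ => by positivity
  have h30 : (9 / 10 : ℝ) ≤ 1 - 30 * ε := by linarith
  exact (mul_le_mul_of_nonneg_right h30 hN).trans h

end Summit.QuantumFields.QCD.Theorems.MobilityGapPinch

end
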